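import Mathlib
import Literature.NumberTheory.LFunctions.Zhang2022.DeltaContourShiftPrelims
import Literature.NumberTheory.LFunctions.Zhang2022.Section7ResidueExtraction
import Literature.NumberTheory.LFunctions.Zhang2022.Section16Eval1617
import HarnessLib

/-!
# Zhang (2022) §15 p. 82 / §16 p. 90: the `Δ`-Mellin contour shift to the exceptional zero and the
# replacement `ρ̃ ↦ 1` — the engine (second half and main theorem)

Topic `Literature/NumberTheory/LFunctions/Zhang2022` (Landau–Siegel audit tree; verdict-neutral).
Y. Zhang, *Discrete mean estimates and the Landau–Siegel zero*, arXiv:2211.02515v1 (2022)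
[Zhang2022LandauSiegel] — **an unrefereed manuscript under adjudication** (ZHANG-L discharge lane).
DAG nodes served: `Z22:§15.u021` [Z22 p.82, tex L4129] and `Z22:§16.u015` [Z22 p.90, tex L4484]:
"In a way similar to the treatment of (7.19), by Lemma 5.5, we see that the expression (15.8)
[(16.4)] is equal to the residue of the integrand at `s = ρ̃` plus an acceptable error. Further, by
(5.15), in the expression for this residue, we can replace `ρ̃` by `1` with an acceptable error."

Continuing `DeltaContourShiftPrelims` (Part 1: the line integral `(1/2πi)∫_{(2)} G(s)L(s,χ)⁻¹yˢδ(s)ds`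
equals `G(ρ̃)y^{ρ̃}δ(ρ̃)/L′(ρ̃,χ)` up to the contour pieces), this file proves

* Part 2 (`norm_residue_sub_main_le`): `G(ρ̃)y^{ρ̃}δ(ρ̃)/L′(ρ̃,χ) − G(1)yδ(1)/L′(1,χ)` is
  `≪ (1 − ρ̃)·𝓛^{O(1)}·M·y` (Schwarz-lemma increments for `Φ = G·yᶻ·δ` and for `L′` on discs
  around `1`, the floor `|L′(ρ̃,χ)| ≫ 1/𝓛` read off the tree's `1/L` bound next to `ρ̃`);
* the bookkeeping (`exists_absorb_contour`, `partOne_arith`, `partTwo_arith`) and the two halves at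
  Zhang's parameters (`partOne_final`: rectangle `[1 − c/(4𝓛), 1 + α] × [−D, D]`;
  `partTwo_final`: discs `ball 1 α`, `ball 1 (1/(2𝓛))`), each `≤ M·y·𝓛⁻²⁰⁰⁰`;
* the ENGINE `deltaContourShift` (main theorem): there is an absolute `C` such that for all large
  `D`, every real primitive `χ (mod D)` with (A), every `G` holomorphic on `σ > 9/10` with
  `‖G‖ ≤ M` on `{1 − 1/(16𝓛) ≤ σ ≤ 2} ∩ ({|t| ≤ D+1} ∪ {σ ≥ 1 + α})`, and every `y` with
  `T ≤ y`, `log y ≤ 3𝓛⁹`: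
  `‖(1/2πi)∫_{(2)} G(s)L(s,χ)⁻¹yˢδ(s)ds − G(1)·y·δ(1)/L′(1,χ)‖ ≤ C·M·y·𝓛⁻²⁰⁰⁰`.
  All analytic inputs are tree theorems: the exceptional zero and the `1/L` floor
  (`Lemma84.exceptional_package` = MV Thms 11.3–11.4 + Zhang's Lemma 5.5/(5.15)), Lemma 5.4
  (`Skeleton.norm_deltaW_le`, `Skeleton.lemma54_holds`), `L ≪ log` near `σ = 1`
  (`Section8Floor.norm_LFunction_le_on_ball`), and the absorption of powers of `𝓛` into
  `exp(−c𝓛^{1/10})` (`Section7dStatements.absorb_pow_log_eps1`).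

The two consumers supply `G = κ̃₁λ₁L(s+β₁)L(s+β₂)` (§15) resp. `κ̃₂λ₂L(s+β₁)` (§16) with
`M = τ(d₁)·𝓛^{O(1)}`, obtaining the printed `O(α¹⁰⁰τ(d₁)Dpk/l₂)`. No new definitions, no named
facts, no `sorry`. Nothing here asserts anything about Theorems 1–2 of the source or about
Landau–Siegel zeros; CONDITIONAL on (A) exactly as every §§5–18 statement of the manuscript.

## References

* Y. Zhang, arXiv:2211.02515v1 (2022), §15 p. 82, §16 p. 90, §7 p. 40, §5 Lemma 5.4–5.5, (5.15).
  [cite: Zhang2022LandauSiegel, §15 p.82; §16 p.90]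
* H. L. Montgomery, R. C. Vaughan, *Multiplicative Number Theory I*, CUP 2007, Thms 11.3–11.4.
  [cite: MontgomeryVaughan2007, Thm 11.4 (11.10)]
-/

noncomputable section

open Complex Real MeasureTheory Set Filter Topology Metric

namespace Literature.NumberTheory.LFunctions.Zhang2022.DeltaContourShift

open Literature.NumberTheory.LFunctions.Zhang2022.Skeleton

/-! ## §5. Increments of holomorphic functions on discs (Schwarz) and the floor for `L′(ρ̃,χ)` -/

section Increments

/-- **Schwarz-lemma increment bound**: `f` holomorphic with `‖f‖ ≤ B` on `ball c R` gives
`‖f(z) − f(c)‖ ≤ (2B/R)·‖z − c‖` for `z ∈ ball c R`. [folklore] -/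
private theorem norm_sub_le_of_ball {f : ℂ → ℂ} {c : ℂ} {R B : ℝ} (hd : DifferentiableOn ℂ f (ball c R))
    (hB : ∀ z ∈ ball c R, ‖f z‖ ≤ B) {z : ℂ} (hz : z ∈ ball c R) :
    ‖f z - f c‖ ≤ 2 * B / R * ‖z - c‖ := by
  have hc : c ∈ ball c R := mem_ball_self (lt_of_le_of_lt dist_nonneg (mem_ball.mp hz))
  have hmaps : MapsTo f (ball c R) (closedBall (f c) (2 * B)) := by
    intro w hw
    rw [mem_closedBall, dist_eq_norm]
    calc ‖f w - f c‖ ≤ ‖f w‖ + ‖f c‖ := norm_sub_le _ _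
      _ ≤ B + B := add_le_add (hB w hw) (hB c hc)
      _ = 2 * B := by ring
  have h := Complex.dist_le_div_mul_dist_of_mapsTo_ball hd hmaps hz
  rwa [dist_eq_norm, dist_eq_norm] at h

/-- **Cauchy estimate for `L′` near `1`**: if `‖L(w,χ)‖ ≤ B_L` on `ball 1 (2r)` (`r > 0`), then
`‖L′(z,χ)‖ ≤ B_L/r` for `z ∈ ball 1 r` (`χ ≠ χ₀`, so `L(·,χ)` is entire). [folklore] -/
private theorem norm_deriv_LFunction_le {N : ℕ} [NeZero N] {χ : DirichletCharacter ℂ N} (hχ : χ ≠ 1)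
    {r BL : ℝ} (hr : 0 < r) (hBL : ∀ w ∈ ball (1 : ℂ) (2 * r), ‖χ.LFunction w‖ ≤ BL)
    {z : ℂ} (hz : z ∈ ball (1 : ℂ) r) :
    ‖deriv χ.LFunction z‖ ≤ BL / r := by
  have hdiff := DirichletCharacter.differentiable_LFunction hχ
  refine Complex.norm_deriv_le_of_forall_mem_sphere_norm_le hr hdiff.diffContOnCl fun w hw => ?_
  refine hBL w ?_
  rw [mem_ball] at hz ⊢
  rw [mem_sphere] at hw
  calc dist w 1 ≤ dist w z + dist z 1 := dist_triangle _ _ _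
    _ < r + r := by rw [hw]; linarith
    _ = 2 * r := by ring

/-- **The floor for `L′(ρ̃,χ)` from the floor for `L` next to `ρ̃`.** If `L(ρ,χ) = 0` and for real
`x ∈ (ρ, ρ+1)` one has `‖L(x,χ)⁻¹‖ ≤ Λ·(1 + |x − ρ|⁻¹)`, then `‖L′(ρ,χ)⁻¹‖ ≤ 2Λ`
(`L′(ρ) = lim L(x)/(x−ρ)` and `‖(x−ρ)/L(x)‖ ≤ Λ(|x−ρ| + 1) ≤ 2Λ`).
[cite: MontgomeryVaughan2007, Thm 11.4 (11.10)] -/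
theorem norm_inv_deriv_le {N : ℕ} [NeZero N] {χ : DirichletCharacter ℂ N} (hχ : χ ≠ 1)
    {ρ Λ : ℝ} (hLρ : χ.LFunction ρ = 0) (hL'ρ : deriv χ.LFunction ρ ≠ 0)
    (hfloor : ∀ x : ℝ, ρ < x → x < ρ + 1 → χ.LFunction x ≠ 0 ∧
      ‖(χ.LFunction x)⁻¹‖ ≤ Λ * (1 + |x - ρ|⁻¹)) :
    ‖(deriv χ.LFunction ρ)⁻¹‖ ≤ 2 * Λ := by
  have hdiff := DirichletCharacter.differentiable_LFunction hχ
  -- the slope tends to `L′(ρ)` along the reals from the right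
  have hslope : Tendsto (slope χ.LFunction (ρ : ℂ)) (𝓝[≠] (ρ : ℂ)) (𝓝 (deriv χ.LFunction ρ)) :=
    hasDerivAt_iff_tendsto_slope.mp (hdiff (ρ : ℂ)).hasDerivAt
  have hemb : Tendsto (fun x : ℝ => (x : ℂ)) (𝓝[>] ρ) (𝓝[≠] (ρ : ℂ)) := by
    refine tendsto_nhdsWithin_iff.mpr ⟨?_, ?_⟩
    · exact (Complex.continuous_ofReal.tendsto ρ).mono_left nhdsWithin_le_nhds
    · filter_upwards [self_mem_nhdsWithin] with x hx
      simp only [mem_compl_iff, mem_singleton_iff, Complex.ofReal_inj]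
      exact ne_of_gt hx
  have hT : Tendsto (fun x : ℝ => ‖(slope χ.LFunction (ρ : ℂ) (x : ℂ))⁻¹‖) (𝓝[>] ρ)
      (𝓝 ‖(deriv χ.LFunction ρ)⁻¹‖) :=
    (((hslope.comp hemb).inv₀ hL'ρ).norm)
  -- the bound along the filter
  have hev : ∀ᶠ x : ℝ in 𝓝[>] ρ, ‖(slope χ.LFunction (ρ : ℂ) (x : ℂ))⁻¹‖ ≤ 2 * Λ := by
    have hmem : Ioo ρ (ρ + 1) ∈ 𝓝[>] ρ := Ioo_mem_nhdsGT (by linarith)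
    filter_upwards [hmem] with x hx
    obtain ⟨hLx, hbd⟩ := hfloor x hx.1 hx.2
    have hxρ : (x : ℂ) - ρ ≠ 0 := by
      rw [← Complex.ofReal_sub]; exact Complex.ofReal_ne_zero.mpr (by linarith [hx.1])
    have hsl : slope χ.LFunction (ρ : ℂ) (x : ℂ) = χ.LFunction x / ((x : ℂ) - ρ) := by
      rw [slope_def_field, hLρ, sub_zero]
    rw [hsl, inv_div, norm_div]
    have hxρ' : ‖(x : ℂ) - ρ‖ = |x - ρ| := by
      rw [← Complex.ofReal_sub, Complex.norm_real, Real.norm_eq_abs]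
    have hpos : 0 < |x - ρ| := abs_pos.mpr (by linarith [hx.1])
    have hle1 : |x - ρ| ≤ 1 := by rw [abs_of_pos (by linarith [hx.1])]; linarith [hx.2]
    rw [div_eq_mul_inv, hxρ', ← norm_inv]
    have hΛ0 : 0 ≤ Λ := by
      have h1 : 0 < ‖(χ.LFunction x)⁻¹‖ := norm_pos_iff.mpr (inv_ne_zero hLx)
      have h2 : 0 < 1 + |x - ρ|⁻¹ := by positivity
      nlinarith
    calc |x - ρ| * ‖(χ.LFunction ↑x)⁻¹‖ ≤ |x - ρ| * (Λ * (1 + |x - ρ|⁻¹)) :=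
          mul_le_mul_of_nonneg_left hbd hpos.le
      _ = Λ * (|x - ρ| + 1) := by field_simp
      _ ≤ Λ * 2 := by gcongr; linarith
      _ = 2 * Λ := by ring
  exact le_of_tendsto hT hev

end Increments

/-! ## §6. Part 2: replacing `ρ̃` by `1` in the residue -/

section PartTwo

variable {D : ℕ} [NeZero D] {χ : DirichletCharacter ℂ D} {G : ℂ → ℂ} {y : ℝ}

/-- **Part 2 (abstract form): `G(ρ)y^ρδ(ρ)/L′(ρ,χ) − G(1)yδ(1)/L′(1,χ)` is small when `1 − ρ` is.**
On a disc `ball 1 r` (`0 < r ≤ 1/20`, `1 − ρ < r`) with `‖G‖ ≤ M`, `‖δ‖ ≤ B_δ`, `y ≥ 1`, the function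
`Φ = G·yᶻ·δ` is holomorphic and bounded by `M·y^{1+r}·B_δ`, so `‖Φ(ρ) − Φ(1)‖ ≤ (2MY B_δ/r)(1−ρ)`
(Schwarz); `‖L′(ρ)⁻¹‖ ≤ 2Λ` (`norm_inv_deriv_le`); `‖L′(1) − L′(ρ)‖ ≤ (2(B_L/r′)/r′)(1−ρ) =: δ_L`
(Schwarz for `L′`, Cauchy estimate from `‖L‖ ≤ B_L` on `ball 1 (2r′)`), whence `‖L′(1)⁻¹‖ ≤ 4Λ` once
`4Λδ_L ≤ 1`. [cite: Zhang2022LandauSiegel, §15 p.82 ("by (5.15) we can replace ρ̃ by 1")] -/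
theorem norm_residue_sub_main_le (hχ : χ ≠ 1)
    (hG : DifferentiableOn ℂ G {s : ℂ | 9 / 10 < s.re}) (hy : 1 ≤ y) (hℓ : 1 ≤ ell D)
    {ρ : ℝ} (hρ1 : ρ < 1) (hLρ : χ.LFunction ρ = 0) (hL'ρ : deriv χ.LFunction ρ ≠ 0)
    {r M Bδ Λ r' BL : ℝ} (hr : 0 < r) (hr20 : r ≤ 1 / 20) (hρr : 1 - ρ < r) (hM : 0 ≤ M)
    (hGB : ∀ z ∈ ball (1 : ℂ) r, ‖G z‖ ≤ M) (hδB : ∀ z ∈ ball (1 : ℂ) r, ‖deltaW D z‖ ≤ Bδ)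
    (hfloor : ∀ x : ℝ, ρ < x → x < ρ + 1 → χ.LFunction x ≠ 0 ∧
      ‖(χ.LFunction x)⁻¹‖ ≤ Λ * (1 + |x - ρ|⁻¹))
    (hr' : 0 < r') (hρr' : 1 - ρ < r') (hBL : ∀ w ∈ ball (1 : ℂ) (2 * r'), ‖χ.LFunction w‖ ≤ BL)
    (hsmall : 4 * Λ * (2 * (BL / r') / r' * (1 - ρ)) ≤ 1) :
    ‖G ρ * (y : ℂ) ^ (ρ : ℂ) * deltaW D ρ / deriv χ.LFunction ρ -
        G 1 * (y : ℂ) * deltaW D 1 / deriv χ.LFunction 1‖ ≤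
      2 * (M * y ^ (1 + r) * Bδ) / r * (1 - ρ) * (2 * Λ) +
        M * y ^ (1 + r) * Bδ * (2 * (BL / r') / r' * (1 - ρ)) * (2 * Λ) * (4 * Λ) := by
  have hy0 : 0 < y := by linarith
  have hdiffL := DirichletCharacter.differentiable_LFunction hχ
  -- `ρ` and `1` in the discs
  have hρball : (ρ : ℂ) ∈ ball (1 : ℂ) r := by
    rw [mem_ball, dist_eq_norm, ← Complex.ofReal_one, ← Complex.ofReal_sub, Complex.norm_real,
      Real.norm_eq_abs, abs_sub_comm, abs_of_pos (by linarith)]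
    exact hρr
  have hρball' : (ρ : ℂ) ∈ ball (1 : ℂ) r' := by
    rw [mem_ball, dist_eq_norm, ← Complex.ofReal_one, ← Complex.ofReal_sub, Complex.norm_real,
      Real.norm_eq_abs, abs_sub_comm, abs_of_pos (by linarith)]
    exact hρr'
  have h1ball : (1 : ℂ) ∈ ball (1 : ℂ) r := mem_ball_self hr
  have hnorm1ρ : ‖(ρ : ℂ) - 1‖ = 1 - ρ := by
    rw [← Complex.ofReal_one, ← Complex.ofReal_sub, Complex.norm_real, Real.norm_eq_abs,
      abs_sub_comm, abs_of_pos (by linarith)]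
  -- nonnegativity of the constants
  have hBδ0 : 0 ≤ Bδ := le_trans (norm_nonneg _) (hδB 1 h1ball)
  have hΛ0 : 0 < Λ := by
    have hx : ρ < ρ + 1 / 2 := by linarith
    obtain ⟨hne, hbd⟩ := hfloor (ρ + 1 / 2) hx (by linarith)
    have h1 : 0 < ‖(χ.LFunction ↑(ρ + 1 / 2))⁻¹‖ := norm_pos_iff.mpr (inv_ne_zero hne)
    have h2 : 0 < 1 + |ρ + 1 / 2 - ρ|⁻¹ := by positivity
    by_contra h
    rw [not_lt] at h
    have : Λ * (1 + |ρ + 1 / 2 - ρ|⁻¹) ≤ 0 := mul_nonpos_of_nonpos_of_nonneg h h2.le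
    linarith
  /- the function `Φ = G · y^z · δ` on `ball 1 r` -/
  set Φ : ℂ → ℂ := fun z => G z * (y : ℂ) ^ z * deltaW D z with hΦ
  have hball9 : ∀ z ∈ ball (1 : ℂ) r, 9 / 10 < z.re := by
    intro z hz
    rw [mem_ball, dist_eq_norm] at hz
    have h := Complex.abs_re_le_norm (z - 1)
    rw [Complex.sub_re, Complex.one_re] at h
    have : |z.re - 1| < 1 / 20 := lt_of_le_of_lt h (lt_of_lt_of_le hz hr20)
    rw [abs_lt] at this; linarith
  have hΦd : DifferentiableOn ℂ Φ (ball (1 : ℂ) r) := by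
    intro z hz
    have hz9 := hball9 z hz
    have h1 : DifferentiableAt ℂ G z :=
      hG.differentiableAt ((isOpen_lt continuous_const Complex.continuous_re).mem_nhds hz9)
    have h3 : DifferentiableAt ℂ (fun s : ℂ => (y : ℂ) ^ s) z :=
      differentiableAt_id.const_cpow (Or.inl (Complex.ofReal_ne_zero.mpr hy0.ne'))
    have h4 : DifferentiableAt ℂ (deltaW D) z := by
      have hd := Lemma53.differentiableOn_delta514 (one_le_ell2 hℓ) (t0 D)
      have hmem : z ∈ {s : ℂ | 0 < s.re} := by
        show 0 < z.re; linarith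
      exact hd.differentiableAt ((isOpen_lt continuous_const Complex.continuous_re).mem_nhds hmem)
    exact ((h1.mul h3).mul h4).differentiableWithinAt
  set Y : ℝ := y ^ (1 + r) with hY
  have hY0 : 0 ≤ Y := Real.rpow_nonneg hy0.le _
  have hΦB : ∀ z ∈ ball (1 : ℂ) r, ‖Φ z‖ ≤ M * Y * Bδ := by
    intro z hz
    have hre : z.re ≤ 1 + r := by
      rw [mem_ball, dist_eq_norm] at hz
      have h := Complex.abs_re_le_norm (z - 1)
      rw [Complex.sub_re, Complex.one_re] at h
      have : |z.re - 1| < r := lt_of_le_of_lt h hz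
      rw [abs_lt] at this; linarith
    simp only [hΦ]
    rw [norm_mul, norm_mul, Complex.norm_cpow_eq_rpow_re_of_pos hy0]
    have hyz : y ^ z.re ≤ Y := Real.rpow_le_rpow_of_exponent_le hy hre
    have hyz0 : 0 ≤ y ^ z.re := Real.rpow_nonneg hy0.le _
    calc ‖G z‖ * y ^ z.re * ‖deltaW D z‖ ≤ M * Y * Bδ := by
          gcongr
          · exact hGB z hz
          · exact hδB z hz
      _ = M * Y * Bδ := rfl
  -- increment of `Φ`
  have hΦinc : ‖Φ ρ - Φ 1‖ ≤ 2 * (M * Y * Bδ) / r * (1 - ρ) := by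
    have h := norm_sub_le_of_ball hΦd hΦB hρball
    rwa [hnorm1ρ] at h
  /- the derivative `L′` -/
  have hu : ‖(deriv χ.LFunction ρ)⁻¹‖ ≤ 2 * Λ := norm_inv_deriv_le hχ hLρ hL'ρ hfloor
  set δL : ℝ := 2 * (BL / r') / r' * (1 - ρ) with hδL
  have hL'd : DifferentiableOn ℂ (deriv χ.LFunction) (ball (1 : ℂ) r') := by
    have hcd : ContDiff ℂ (1 + 1) χ.LFunction := hdiffL.contDiff
    have h1 : ContDiff ℂ 1 (deriv χ.LFunction) := (contDiff_succ_iff_deriv.mp hcd).2.2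
    exact (h1.differentiable one_ne_zero).differentiableOn
  have hL'B : ∀ z ∈ ball (1 : ℂ) r', ‖deriv χ.LFunction z‖ ≤ BL / r' := fun z hz =>
    norm_deriv_LFunction_le hχ hr' hBL hz
  have hL'inc : ‖deriv χ.LFunction ρ - deriv χ.LFunction 1‖ ≤ δL := by
    have h := norm_sub_le_of_ball hL'd hL'B hρball'
    rwa [hnorm1ρ] at h
  have hδL0 : 0 ≤ δL := le_trans (norm_nonneg _) hL'inc
  -- the floor for `L′(1)`
  have hL'ρ_ge : 1 / (2 * Λ) ≤ ‖deriv χ.LFunction ρ‖ := by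
    have hpos : 0 < ‖deriv χ.LFunction ρ‖ := norm_pos_iff.mpr hL'ρ
    rw [norm_inv] at hu
    rw [div_le_iff₀ (by positivity)]
    calc 1 = ‖deriv χ.LFunction ↑ρ‖⁻¹ * ‖deriv χ.LFunction ↑ρ‖ := by
          rw [inv_mul_cancel₀ hpos.ne']
      _ ≤ 2 * Λ * ‖deriv χ.LFunction ↑ρ‖ := mul_le_mul_of_nonneg_right hu hpos.le
      _ = ‖deriv χ.LFunction ↑ρ‖ * (2 * Λ) := by ring
  have hL'1_ge : 1 / (4 * Λ) ≤ ‖deriv χ.LFunction 1‖ := by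
    have h1 : ‖deriv χ.LFunction ρ‖ - δL ≤ ‖deriv χ.LFunction 1‖ := by
      have := norm_sub_norm_le (deriv χ.LFunction ρ) (deriv χ.LFunction 1)
      linarith [hL'inc]
    have h2 : δL ≤ 1 / (4 * Λ) := by
      rw [le_div_iff₀ (by positivity)]
      calc δL * (4 * Λ) = 4 * Λ * δL := by ring
        _ ≤ 1 := hsmall
    have h3 : 1 / (2 * Λ) - 1 / (4 * Λ) = 1 / (4 * Λ) := by field_simp; ring
    linarith
  have hL'1_ne : deriv χ.LFunction 1 ≠ 0 := by
    intro h
    rw [h, norm_zero] at hL'1_ge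
    have : 0 < 1 / (4 * Λ) := by positivity
    linarith
  have hv : ‖(deriv χ.LFunction 1)⁻¹‖ ≤ 4 * Λ := by
    rw [norm_inv, inv_le_comm₀ (norm_pos_iff.mpr hL'1_ne) (by positivity)]
    rw [one_div] at hL'1_ge
    exact hL'1_ge
  -- `‖u − v‖ ≤ δL·‖u‖·‖v‖`
  have huv : ‖(deriv χ.LFunction ρ)⁻¹ - (deriv χ.LFunction 1)⁻¹‖ ≤ δL * (2 * Λ) * (4 * Λ) := by
    have hid : (deriv χ.LFunction ρ)⁻¹ - (deriv χ.LFunction 1)⁻¹ =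
        (deriv χ.LFunction 1 - deriv χ.LFunction ρ) *
          ((deriv χ.LFunction ρ)⁻¹ * (deriv χ.LFunction 1)⁻¹) := by
      field_simp
    rw [hid, norm_mul, norm_mul, norm_sub_rev]
    have h0 : 0 ≤ ‖(deriv χ.LFunction ↑ρ)⁻¹‖ := norm_nonneg _
    have h0' : 0 ≤ ‖(deriv χ.LFunction 1)⁻¹‖ := norm_nonneg _
    calc ‖deriv χ.LFunction ↑ρ - deriv χ.LFunction 1‖ *
          (‖(deriv χ.LFunction ↑ρ)⁻¹‖ * ‖(deriv χ.LFunction 1)⁻¹‖)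
        ≤ δL * ((2 * Λ) * (4 * Λ)) := by
          gcongr
      _ = δL * (2 * Λ) * (4 * Λ) := by ring
  /- assembly -/
  have hΦρ : G ρ * (y : ℂ) ^ (ρ : ℂ) * deltaW D ρ = Φ ρ := rfl
  have hΦ1 : G 1 * (y : ℂ) * deltaW D 1 = Φ 1 := by
    simp only [hΦ, Complex.cpow_one]
  rw [div_eq_mul_inv, div_eq_mul_inv, hΦρ, hΦ1]
  have hsplit : Φ ρ * (deriv χ.LFunction ρ)⁻¹ - Φ 1 * (deriv χ.LFunction 1)⁻¹ =
      (Φ ρ - Φ 1) * (deriv χ.LFunction ρ)⁻¹ +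
        Φ 1 * ((deriv χ.LFunction ρ)⁻¹ - (deriv χ.LFunction 1)⁻¹) := by ring
  rw [hsplit]
  have hΦ1B : ‖Φ 1‖ ≤ M * Y * Bδ := hΦB 1 h1ball
  have hMYB : 0 ≤ M * Y * Bδ := by positivity
  calc ‖(Φ ↑ρ - Φ 1) * (deriv χ.LFunction ↑ρ)⁻¹ +
          Φ 1 * ((deriv χ.LFunction ↑ρ)⁻¹ - (deriv χ.LFunction 1)⁻¹)‖
      ≤ ‖(Φ ↑ρ - Φ 1) * (deriv χ.LFunction ↑ρ)⁻¹‖ +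
          ‖Φ 1 * ((deriv χ.LFunction ↑ρ)⁻¹ - (deriv χ.LFunction 1)⁻¹)‖ := norm_add_le _ _
    _ = ‖Φ ↑ρ - Φ 1‖ * ‖(deriv χ.LFunction ↑ρ)⁻¹‖ +
          ‖Φ 1‖ * ‖(deriv χ.LFunction ↑ρ)⁻¹ - (deriv χ.LFunction 1)⁻¹‖ := by
        rw [norm_mul, norm_mul]
    _ ≤ 2 * (M * Y * Bδ) / r * (1 - ρ) * (2 * Λ) + M * Y * Bδ * (δL * (2 * Λ) * (4 * Λ)) := by
        gcongr
    _ = _ := by rw [hδL]; ring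

end PartTwo

/-! ## §7. Absorbing powers of `𝓛` -/

section Absorb

/-- `e^{−𝓛} ≤ ε₁(c₀) = exp(−c₀𝓛^{1/10})` for `0 < c₀ ≤ 1` and `𝓛 ≥ 1`. [folklore] -/
private theorem exp_neg_ell_le_eps1 {D : ℕ} (hℓ : 1 ≤ ell D) {c₀ : ℝ} (hc₀ : 0 < c₀) (hc1 : c₀ ≤ 1) :
    Real.exp (-ell D) ≤ Section7dStatements.eps1 c₀ D := by
  rw [Section7dStatements.eps1, Real.exp_le_exp, neg_le_neg_iff]
  have hℓ0 : 0 ≤ ell D := by linarith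
  have h1 : ell D ^ ((1 : ℝ) / 10) ≤ ell D := by
    calc ell D ^ ((1 : ℝ) / 10) ≤ ell D ^ (1 : ℝ) :=
          Real.rpow_le_rpow_of_exponent_le hℓ (by norm_num)
      _ = ell D := Real.rpow_one _
  have h2 : 0 ≤ ell D ^ ((1 : ℝ) / 10) := Real.rpow_nonneg hℓ0 _
  nlinarith

/-- **`A·𝓛⁵²⁰⁰·(e^{−𝓛} + ε₁(c₀)) ≤ 𝓛⁻²⁰⁰⁰` for all large `D`** (`A ≥ 0`, `0 < c₀ ≤ 1`), by the tree's
`absorb_pow_log_eps1` (`2A𝓛⁷²⁰⁰ε₁(c₀) ≤ ε₁(c₀/2) ≤ 1`). [cite: Zhang2022LandauSiegel, §7 p.40] -/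
theorem exists_absorb_contour (A c₀ : ℝ) (hA : 0 ≤ A) (hc₀ : 0 < c₀) (hc1 : c₀ ≤ 1) :
    ∃ D₀ : ℕ, ∀ D : ℕ, D₀ ≤ D → 1 ≤ ell D →
      A * ell D ^ 5200 * (Real.exp (-ell D) + Section7dStatements.eps1 c₀ D) ≤ (ell D ^ 2000)⁻¹ := by
  obtain ⟨D₁, hD₁⟩ := Section7dStatements.absorb_pow_log_eps1 (2 * A) 7200 c₀ hc₀
  refine ⟨D₁, fun D hD hℓ => ?_⟩
  have hℓ0 : 0 < ell D := by linarith
  have heps0 : 0 ≤ Section7dStatements.eps1 c₀ D := (Real.exp_pos _).le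
  have h1 : Real.exp (-ell D) + Section7dStatements.eps1 c₀ D ≤ 2 * Section7dStatements.eps1 c₀ D := by
    linarith [exp_neg_ell_le_eps1 hℓ hc₀ hc1]
  have h2 : Section7dStatements.eps1 (c₀ / 2) D ≤ 1 := by
    rw [Section7dStatements.eps1]
    refine Real.exp_le_one_iff.mpr ?_
    have : 0 ≤ ell D ^ ((1 : ℝ) / 10) := Real.rpow_nonneg hℓ0.le _
    nlinarith
  have h3 := hD₁ D hD
  have hpow : ell D ^ 7200 = ell D ^ 5200 * ell D ^ 2000 := by rw [← pow_add]
  rw [hpow] at h3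
  have h2000 : 0 < ell D ^ 2000 := by positivity
  calc A * ell D ^ 5200 * (Real.exp (-ell D) + Section7dStatements.eps1 c₀ D)
      ≤ A * ell D ^ 5200 * (2 * Section7dStatements.eps1 c₀ D) := by gcongr
    _ = (2 * A * (ell D ^ 5200 * ell D ^ 2000) * Section7dStatements.eps1 c₀ D) /
          ell D ^ 2000 := by field_simp
    _ ≤ Section7dStatements.eps1 (c₀ / 2) D / ell D ^ 2000 :=
        div_le_div_of_nonneg_right h3 h2000.le
    _ ≤ 1 / ell D ^ 2000 := div_le_div_of_nonneg_right h2 h2000.le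
    _ = (ell D ^ 2000)⁻¹ := one_div _

end Absorb

/-! ## §8. The two bookkeeping inequalities (pure real arithmetic) -/

section Arith

/-- **Bookkeeping for Part 1**: the three contour pieces, with `b/(b−1) ≤ 𝓛⁹`, `y^b ≤ ye^{3π}`,
`y^a ≤ yε₁`, `b − a ≤ 1`, `T = D = e^𝓛`, are at most `M·y·A·(Q𝓛¹⁰)·(e^{−𝓛} + ε₁)` with
`A = 2e^{3π} + 16e^{3π}C_L + 16πC_L(1 + 8/c)` (`Q` stands for `C_δ𝓛⁵¹⁹⁰`).
[cite: Zhang2022LandauSiegel, §15 p.82] -/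
theorem partOne_arith {ℓ c CL Q M y yb ya E B1 ba : ℝ} (hℓ : 2 ≤ ℓ) (hc : 0 < c)
    (hCL : 0 ≤ CL) (hQ : 0 ≤ Q) (hM : 0 ≤ M) (hy : 0 ≤ y) (hE : 0 ≤ E) (hyb0 : 0 ≤ yb)
    (hya0 : 0 ≤ ya) (hyb : yb ≤ y * Real.exp (3 * π)) (hya : ya ≤ y * E) (hB1 : 0 ≤ B1)
    (hB1' : B1 ≤ ℓ ^ 9) (hba0 : 0 ≤ ba) (hba : ba ≤ 1) :
    1 / (2 * π) * (2 * (M * B1 * yb * Q / Real.exp ℓ) +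
        M * (CL * (4 * ℓ) * (1 + 8 * ℓ / c)) * ya * Q * (4 * π) +
        2 * (ba * (M * (CL * (4 * ℓ) * 2) * yb * Q / Real.exp ℓ ^ 2))) ≤
      M * y * ((2 * Real.exp (3 * π) + 16 * Real.exp (3 * π) * CL +
        16 * π * CL * (1 + 8 / c)) * (Q * ℓ ^ 10) * (Real.exp (-ℓ) + E)) := by
  have hℓ1 : 1 ≤ ℓ := by linarith
  have hℓ0 : 0 < ℓ := by linarith
  have hX0 : 0 < Real.exp (3 * π) := Real.exp_pos _
  have hexp : (Real.exp ℓ)⁻¹ = Real.exp (-ℓ) := by rw [Real.exp_neg]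
  have hexp0 : 0 < Real.exp (-ℓ) := Real.exp_pos _
  have hexp2 : (Real.exp ℓ ^ 2)⁻¹ ≤ Real.exp (-ℓ) := by
    rw [← hexp]
    refine inv_anti₀ (Real.exp_pos _) ?_
    have h1 : 1 ≤ Real.exp ℓ := Real.one_le_exp hℓ0.le
    nlinarith
  have h9 : ℓ ^ 9 ≤ ℓ ^ 10 := pow_le_pow_right₀ hℓ1 (by norm_num)
  have h2' : ℓ ^ 2 ≤ ℓ ^ 10 := pow_le_pow_right₀ hℓ1 (by norm_num)
  have h1' : ℓ ≤ ℓ ^ 10 := by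
    calc ℓ = ℓ ^ 1 := (pow_one ℓ).symm
      _ ≤ ℓ ^ 10 := pow_le_pow_right₀ hℓ1 (by norm_num)
  -- the three terms
  have hT1 : 2 * (M * B1 * yb * Q / Real.exp ℓ) ≤
      M * y * ((2 * Real.exp (3 * π)) * (Q * ℓ ^ 10) * Real.exp (-ℓ)) := by
    calc 2 * (M * B1 * yb * Q / Real.exp ℓ) = 2 * (M * B1 * yb * Q) * (Real.exp ℓ)⁻¹ := by
          rw [div_eq_mul_inv]; ring
      _ ≤ 2 * (M * ℓ ^ 10 * (y * Real.exp (3 * π)) * Q) * Real.exp (-ℓ) := by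
          rw [hexp]; gcongr; exact hB1'.trans h9
      _ = M * y * ((2 * Real.exp (3 * π)) * (Q * ℓ ^ 10) * Real.exp (-ℓ)) := by ring
  have hT2 : M * (CL * (4 * ℓ) * (1 + 8 * ℓ / c)) * ya * Q * (4 * π) ≤
      M * y * ((16 * π * CL * (1 + 8 / c)) * (Q * ℓ ^ 10) * E) := by
    have h1 : ℓ * (1 + 8 * ℓ / c) ≤ (1 + 8 / c) * ℓ ^ 10 := by
      have e1 : ℓ * (1 + 8 * ℓ / c) = (1 + 8 / c) * ℓ ^ 2 - (ℓ ^ 2 - ℓ) := by ring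
      have e2 : 0 ≤ ℓ ^ 2 - ℓ := by nlinarith
      have e3 : (1 + 8 / c) * ℓ ^ 2 ≤ (1 + 8 / c) * ℓ ^ 10 := by
        have : 0 ≤ 1 + 8 / c := by positivity
        exact mul_le_mul_of_nonneg_left h2' this
      linarith
    calc M * (CL * (4 * ℓ) * (1 + 8 * ℓ / c)) * ya * Q * (4 * π)
        = (16 * π) * M * CL * (ℓ * (1 + 8 * ℓ / c)) * ya * Q := by ring
      _ ≤ (16 * π) * M * CL * ((1 + 8 / c) * ℓ ^ 10) * (y * E) * Q := by gcongr
      _ = M * y * ((16 * π * CL * (1 + 8 / c)) * (Q * ℓ ^ 10) * E) := by ring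
  have hT3 : 2 * (ba * (M * (CL * (4 * ℓ) * 2) * yb * Q / Real.exp ℓ ^ 2)) ≤
      M * y * ((16 * Real.exp (3 * π) * CL) * (Q * ℓ ^ 10) * Real.exp (-ℓ)) := by
    calc 2 * (ba * (M * (CL * (4 * ℓ) * 2) * yb * Q / Real.exp ℓ ^ 2))
        = 16 * ba * M * CL * yb * (ℓ * Q) * (Real.exp ℓ ^ 2)⁻¹ := by rw [div_eq_mul_inv]; ring
      _ ≤ 16 * 1 * M * CL * (y * Real.exp (3 * π)) * (ℓ ^ 10 * Q) * Real.exp (-ℓ) := by gcongr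
      _ = M * y * ((16 * Real.exp (3 * π) * CL) * (Q * ℓ ^ 10) * Real.exp (-ℓ)) := by ring
  have hsum0 : 0 ≤ 2 * (M * B1 * yb * Q / Real.exp ℓ) +
      M * (CL * (4 * ℓ) * (1 + 8 * ℓ / c)) * ya * Q * (4 * π) +
      2 * (ba * (M * (CL * (4 * ℓ) * 2) * yb * Q / Real.exp ℓ ^ 2)) := by positivity
  have hπ1 : 1 / (2 * π) ≤ 1 := by
    rw [div_le_one (by positivity)]; linarith [Real.pi_gt_three]
  have hMy : 0 ≤ M * y := by positivity
  have hQ10 : 0 ≤ Q * ℓ ^ 10 := by positivity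
  have k1 : 0 ≤ M * y * ((2 * Real.exp (3 * π)) * (Q * ℓ ^ 10) * E) := by positivity
  have k2 : 0 ≤ M * y * ((16 * π * CL * (1 + 8 / c)) * (Q * ℓ ^ 10) * Real.exp (-ℓ)) := by
    positivity
  have k3 : 0 ≤ M * y * ((16 * Real.exp (3 * π) * CL) * (Q * ℓ ^ 10) * E) := by positivity
  calc 1 / (2 * π) * (2 * (M * B1 * yb * Q / Real.exp ℓ) +
        M * (CL * (4 * ℓ) * (1 + 8 * ℓ / c)) * ya * Q * (4 * π) +
        2 * (ba * (M * (CL * (4 * ℓ) * 2) * yb * Q / Real.exp ℓ ^ 2)))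
      ≤ 1 * (2 * (M * B1 * yb * Q / Real.exp ℓ) +
        M * (CL * (4 * ℓ) * (1 + 8 * ℓ / c)) * ya * Q * (4 * π) +
        2 * (ba * (M * (CL * (4 * ℓ) * 2) * yb * Q / Real.exp ℓ ^ 2))) :=
        mul_le_mul_of_nonneg_right hπ1 hsum0
    _ ≤ M * y * ((2 * Real.exp (3 * π)) * (Q * ℓ ^ 10) * Real.exp (-ℓ)) +
          M * y * ((16 * π * CL * (1 + 8 / c)) * (Q * ℓ ^ 10) * E) +
          M * y * ((16 * Real.exp (3 * π) * CL) * (Q * ℓ ^ 10) * Real.exp (-ℓ)) := by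
        rw [one_mul]; exact add_le_add (add_le_add hT1 hT2) hT3
    _ ≤ _ := by nlinarith [k1, k2, k3]

/-- **Bookkeeping for Part 2**: with `Y ≤ ye^{3π}`, `0 ≤ B_δ ≤ B₀`, `1/α ≤ 𝓛⁹`, `Λ ≤ 3C_L𝓛`,
`W = 8𝓛²B_L ≤ 32e⁴𝓛³`, `1 − ρ ≤ ε`, the two Part-2 terms are at most `M·y·A₂'·𝓛¹⁰·ε` with
`A₂' = e^{3π}B₀(12C_L + 2304e⁴C_L²)`. [cite: Zhang2022LandauSiegel, §15 p.82] -/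
theorem partTwo_arith {ℓ CL M y Y Bδ B₀ α Λ W ε δ : ℝ} (hℓ : 1 ≤ ℓ) (hCL : 0 ≤ CL) (hM : 0 ≤ M)
    (hy : 0 ≤ y) (hY : Y ≤ y * Real.exp (3 * π)) (hBδ0 : 0 ≤ Bδ) (hBδ : Bδ ≤ B₀)
    (hα : 0 < α) (hαℓ : α⁻¹ ≤ ℓ ^ 9) (hΛ0 : 0 ≤ Λ) (hΛ : Λ ≤ 3 * CL * ℓ) (hW0 : 0 ≤ W)
    (hW : W ≤ 32 * Real.exp 4 * ℓ ^ 3) (hδ0 : 0 ≤ δ) (hδ : δ ≤ ε) :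
    2 * (M * Y * Bδ) / α * δ * (2 * Λ) + M * Y * Bδ * (W * δ) * (2 * Λ) * (4 * Λ) ≤
      M * y * (Real.exp (3 * π) * B₀ * (12 * CL + 2304 * Real.exp 4 * CL ^ 2) * ℓ ^ 10 * ε) := by
  have hX0 : 0 < Real.exp (3 * π) := Real.exp_pos _
  have hB₀ : 0 ≤ B₀ := hBδ0.trans hBδ
  have hε : 0 ≤ ε := hδ0.trans hδ
  have hℓ0 : 0 < ℓ := by linarith
  have hA : 2 * (M * Y * Bδ) / α * δ * (2 * Λ) ≤
      M * y * (Real.exp (3 * π) * B₀ * (12 * CL) * ℓ ^ 10 * ε) := by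
    calc 2 * (M * Y * Bδ) / α * δ * (2 * Λ) = 4 * M * Y * Bδ * α⁻¹ * δ * Λ := by
          rw [div_eq_mul_inv]; ring
      _ ≤ 4 * M * (y * Real.exp (3 * π)) * B₀ * ℓ ^ 9 * ε * (3 * CL * ℓ) := by gcongr
      _ = M * y * (Real.exp (3 * π) * B₀ * (12 * CL) * ℓ ^ 10 * ε) := by ring
  have hB : M * Y * Bδ * (W * δ) * (2 * Λ) * (4 * Λ) ≤
      M * y * (Real.exp (3 * π) * B₀ * (2304 * Real.exp 4 * CL ^ 2) * ℓ ^ 10 * ε) := by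
    have h5 : ℓ ^ 5 ≤ ℓ ^ 10 := pow_le_pow_right₀ hℓ (by norm_num)
    have hΛΛ : Λ * Λ ≤ (3 * CL * ℓ) * (3 * CL * ℓ) := mul_le_mul hΛ hΛ hΛ0 (by positivity)
    calc M * Y * Bδ * (W * δ) * (2 * Λ) * (4 * Λ) = 8 * M * Y * Bδ * W * δ * (Λ * Λ) := by ring
      _ ≤ 8 * M * (y * Real.exp (3 * π)) * B₀ * (32 * Real.exp 4 * ℓ ^ 3) * ε *
            ((3 * CL * ℓ) * (3 * CL * ℓ)) := by gcongr
      _ = M * y * (Real.exp (3 * π) * B₀ * (2304 * Real.exp 4 * CL ^ 2) * ℓ ^ 5 * ε) := by ring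
      _ ≤ M * y * (Real.exp (3 * π) * B₀ * (2304 * Real.exp 4 * CL ^ 2) * ℓ ^ 10 * ε) := by
          gcongr
  calc 2 * (M * Y * Bδ) / α * δ * (2 * Λ) + M * Y * Bδ * (W * δ) * (2 * Λ) * (4 * Λ)
      ≤ M * y * (Real.exp (3 * π) * B₀ * (12 * CL) * ℓ ^ 10 * ε) +
        M * y * (Real.exp (3 * π) * B₀ * (2304 * Real.exp 4 * CL ^ 2) * ℓ ^ 10 * ε) :=
        add_le_add hA hB
    _ = M * y * (Real.exp (3 * π) * B₀ * (12 * CL + 2304 * Real.exp 4 * CL ^ 2) * ℓ ^ 10 * ε) := by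
        ring

end Arith

/-! ## §9. Part 1 and Part 2 at Zhang's parameters -/

section Final

variable {D : ℕ} [NeZero D] {χ : DirichletCharacter ℂ D} {G F : ℂ → ℂ} {y : ℝ}

/-- Monotonicity of the zero-free region in `|t|`: if `|t| ≤ T` then
`1 − c/(log D + log(|t|+4)) ≤ 1 − c/(log D + log(T+4))` (`c ≥ 0`). [folklore] -/
private theorem region_mono' {c : ℝ} (hc : 0 ≤ c) (D : ℕ) {t T : ℝ} (ht : |t| ≤ T) :
    1 - c / (Real.log D + Real.log (|t| + 4)) ≤ 1 - c / (Real.log D + Real.log (T + 4)) := by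
  have h0 : 0 < Real.log D + Real.log (|t| + 4) := by
    have h1 : 0 ≤ Real.log (D : ℝ) := Real.log_natCast_nonneg D
    have h2 : 0 < Real.log (|t| + 4) := Real.log_pos (by linarith [abs_nonneg t])
    linarith
  have h1 : Real.log (|t| + 4) ≤ Real.log (T + 4) :=
    Real.log_le_log (by linarith [abs_nonneg t]) (by linarith)
  have h2 : c / (Real.log D + Real.log (T + 4)) ≤ c / (Real.log D + Real.log (|t| + 4)) :=
    div_le_div_of_nonneg_left hc h0 (by linarith)
  linarith

/-- `log 3 ≤ 2` and `log 4 ≤ 3` (from `log x ≤ x − 1`). [folklore] -/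
private theorem log_three_four : Real.log 3 ≤ 2 ∧ Real.log 4 ≤ 3 := by
  constructor
  · have := Real.log_le_sub_one_of_pos (by norm_num : (0 : ℝ) < 3); linarith
  · have := Real.log_le_sub_one_of_pos (by norm_num : (0 : ℝ) < 4); linarith

/-- For `z ∈ ball 1 r`: `1 − r < Re z < 1 + r` and `|Im z| < r`. [folklore] -/
private theorem re_im_of_mem_ball {z : ℂ} {r : ℝ} (hz : z ∈ ball (1 : ℂ) r) :
    1 - r < z.re ∧ z.re < 1 + r ∧ |z.im| < r := by
  rw [mem_ball, dist_eq_norm] at hz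
  have h1 := Complex.abs_re_le_norm (z - 1)
  have h2 := Complex.abs_im_le_norm (z - 1)
  rw [Complex.sub_re, Complex.one_re] at h1
  rw [Complex.sub_im, Complex.one_im, sub_zero] at h2
  have h1' : |z.re - 1| < r := lt_of_le_of_lt h1 hz
  rw [abs_lt] at h1'
  exact ⟨by linarith, by linarith, lt_of_le_of_lt h2 hz⟩

set_option maxHeartbeats 800000 in -- one long parameter bookkeeping (rectangle data, 1/L bounds, y-powers)
/-- **Part 1 at Zhang's parameters.** Rectangle `[1 − c/(4𝓛), 1 + α] × [−D, D]`, `T ≤ y`,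
`log y ≤ 3𝓛⁹`, the zero-free/floor data of `Lemma84.exceptional_package` (with `𝓛 ≥ 8K/c`), and
the absorption hypothesis `A₁𝓛⁵²⁰⁰(e^{−𝓛} + ε₁(c/4)) ≤ 𝓛⁻²⁰⁰⁰`: then
`‖(1/2πi)∫_{(2)}F − G(ρ)y^ρδ(ρ)/L′(ρ,χ)‖ ≤ M·y·𝓛⁻²⁰⁰⁰`. [cite: Zhang2022LandauSiegel, §15 p.82; §16 p.90] -/
theorem partOne_final (hχ : χ ≠ 1) (hG : DifferentiableOn ℂ G {s : ℂ | 9 / 10 < s.re})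
    (hF : ∀ s, F s = G s * (χ.LFunction s)⁻¹ * (y : ℂ) ^ s * deltaW D s) (hℓ8 : 8 ≤ ell D)
    {Cδ : ℝ} (hCδ0 : 0 ≤ Cδ)
    (hCδ : ∀ s : ℂ, 1 / 2 ≤ s.re → s.re ≤ 2 → ‖deltaW D s‖ ≤ Cδ * ell D ^ 5190 * ‖s‖⁻¹ ^ 2)
    {c CL K : ℝ} (hc : 0 < c) (hc4 : c ≤ 1 / 4) (hCL : 0 ≤ CL) {ρ : ℝ} (hρ1 : ρ < 1)
    (hρK : 1 - ρ ≤ K * (ell D ^ 2022)⁻¹) (hLρ : χ.LFunction ρ = 0)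
    (hL'ρ : deriv χ.LFunction ρ ≠ 0)
    (hfl : ∀ s : ℂ, 1 - c / (ell D + Real.log (|s.im| + 4)) ≤ s.re → s ≠ ρ →
      χ.LFunction s ≠ 0 ∧
        ‖(χ.LFunction s)⁻¹‖ ≤ CL * (ell D + Real.log (|s.im| + 4)) * (1 + ‖s - ρ‖⁻¹))
    (hKℓ : 8 * K / c ≤ ell D) {M : ℝ} (hM : 0 ≤ M)
    (hGM : ∀ s : ℂ, 1 - 1 / (16 * ell D) ≤ s.re → s.re ≤ 2 →
      (|s.im| ≤ (D : ℝ) + 1 ∨ 1 + alpha D ≤ s.re) → ‖G s‖ ≤ M)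
    (hTy : bigT D ≤ y) (hlogy : Real.log y ≤ 3 * ell D ^ 9)
    (habs : (2 * Real.exp (3 * π) + 16 * Real.exp (3 * π) * CL + 16 * π * CL * (1 + 8 / c)) * Cδ *
      ell D ^ 5200 * (Real.exp (-ell D) + Section7dStatements.eps1 (c / 4) D) ≤ (ell D ^ 2000)⁻¹) :
    ‖(1 / (2 * π) : ℂ) * (∫ t : ℝ, F ((2 : ℝ) + t * I)) -
        G ρ * (y : ℂ) ^ (ρ : ℂ) * deltaW D ρ / deriv χ.LFunction ρ‖ ≤ M * y * (ell D ^ 2000)⁻¹ := by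
  /- parameters -/
  have hℓ4 : 4 ≤ ell D := by linarith only [hℓ8]
  have hℓ2 : 2 ≤ ell D := by linarith only [hℓ8]
  have hℓ1 : 1 ≤ ell D := by linarith only [hℓ8]
  have hℓ0 : 0 < ell D := by linarith only [hℓ8]
  obtain ⟨hD3r, hD3, hDexp, hα0, hαℓ, hℓinv, hαlogP, hlogP, hαval⟩ := param_facts hℓ4
  have hℓpow : ∀ n : ℕ, n ≠ 0 → ell D ≤ ell D ^ n := fun n hn => le_self_pow₀ hℓ1 hn
  have hℓ2022 : 0 < ell D ^ 2022 := by positivity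
  obtain ⟨hlog3, hlog4⟩ := log_three_four
  -- `K/ℓ²⁰²² ≤ c/(8ℓ)`
  have hs1 : K * (ell D ^ 2022)⁻¹ ≤ c / (8 * ell D) := by
    have h1 : 8 * K / c ≤ ell D ^ 2021 := hKℓ.trans (hℓpow 2021 (by norm_num))
    rw [div_le_iff₀ hc] at h1
    rw [← div_eq_mul_inv, div_le_div_iff₀ hℓ2022 (by positivity)]
    calc K * (8 * ell D) = 8 * K * ell D := by ring
      _ ≤ ell D ^ 2021 * c * ell D := by gcongr
      _ = c * ell D ^ 2022 := by ring
  have hρc8 : 1 - ρ ≤ c / (8 * ell D) := hρK.trans hs1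
  have hc8ℓ : c / (8 * ell D) ≤ 1 / 64 := by
    rw [div_le_div_iff₀ (by positivity) (by norm_num)]; linarith only [hc4, hℓ8]
  have hρ9 : 9 / 10 < ρ := by linarith only [hρc8, hc8ℓ]
  /- `y` -/
  have hT1 : 1 ≤ bigT D := by rw [bigT]; exact Real.one_le_exp (by positivity)
  have hy1 : 1 ≤ y := hT1.trans hTy
  have hy0 : 0 < y := by linarith only [hy1]
  have hyα : y ^ alpha D ≤ Real.exp (3 * π) := by
    rw [Real.rpow_def_of_pos hy0, Real.exp_le_exp]
    calc Real.log y * alpha D ≤ 3 * ell D ^ 9 * alpha D :=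
          mul_le_mul_of_nonneg_right hlogy hα0.le
      _ = 3 * π := by rw [hαval]; field_simp
  have hyc : y ^ (-(c / (4 * ell D))) ≤ Section7dStatements.eps1 (c / 4) D := by
    have h1 : y ^ (-(c / (4 * ell D))) ≤ bigT D ^ (-(c / (4 * ell D))) :=
      Real.rpow_le_rpow_of_nonpos (by linarith only [hT1]) hTy (by
        have : 0 ≤ c / (4 * ell D) := by positivity
        linarith only [this])
    refine h1.trans (le_of_eq ?_)
    rw [Section7dStatements.eps1, bigT, ← Real.exp_mul]
    congr 1
    have h11 : ell D ^ (1.1 : ℝ) = ell D * ell D ^ ((1 : ℝ) / 10) := by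
      rw [show (1.1 : ℝ) = 1 + (1 : ℝ) / 10 by norm_num, Real.rpow_add hℓ0, Real.rpow_one]
    rw [h11]
    field_simp
  /- the rectangle -/
  obtain ⟨a, ha⟩ : ∃ a : ℝ, a = 1 - c / (4 * ell D) := ⟨_, rfl⟩
  obtain ⟨b, hb⟩ : ∃ b : ℝ, b = 1 + alpha D := ⟨_, rfl⟩
  have hc4ℓ : c / (4 * ell D) ≤ 1 / 32 := by
    rw [div_le_div_iff₀ (by positivity) (by norm_num)]; linarith only [hc4, hℓ8]
  have hc4ℓ' : c / (4 * ell D) ≤ 1 / (16 * ell D) := by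
    rw [div_le_div_iff₀ (by positivity) (by positivity)]; nlinarith only [hc4, hℓ0]
  have hc4ℓ0 : 0 < c / (4 * ell D) := by positivity
  have ha12 : 1 / 2 ≤ a := by rw [ha]; linarith only [hc4ℓ]
  have ha9 : 9 / 10 < a := by rw [ha]; linarith only [hc4ℓ]
  have hc84 : c / (4 * ell D) = c / (8 * ell D) + c / (8 * ell D) := by field_simp; ring
  have haρ : a < ρ := by rw [ha]; linarith only [hρc8, hc84, hc4ℓ0]
  have hρa : c / (8 * ell D) ≤ ρ - a := by rw [ha]; linarith only [hρc8, hc84]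
  have hρb : ρ < b := by rw [hb]; linarith only [hρ1, hα0]
  have hb1 : 1 < b := by rw [hb]; linarith only [hα0]
  have hα4 : alpha D ≤ 1 / 4 := hαℓ.trans hℓinv
  have hb2 : b ≤ 2 := by rw [hb]; linarith only [hα4]
  have hba0 : 0 ≤ b - a := by linarith only [haρ, hρb]
  have hba1 : b - a ≤ 1 := by rw [ha, hb]; linarith only [hα4, hc4ℓ]
  have hD1r : (1 : ℝ) ≤ D := by linarith only [hD3r]
  -- `log(D + 4) < 3ℓ`: the rectangle lies in the zero-free region
  have hlogD4 : Real.log ((D : ℝ) + 4) < 3 * ell D := by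
    have hD0 : (0 : ℝ) ≤ (D : ℝ) := Nat.cast_nonneg D
    have h33 : (3 : ℝ) * 3 ≤ (D : ℝ) * D := mul_le_mul hD3r hD3r (by norm_num) hD0
    have h9D : 9 * (D : ℝ) ≤ (D : ℝ) * D * D :=
      mul_le_mul_of_nonneg_right (by linarith only [h33]) hD0
    have h1 : (D : ℝ) + 4 < (D : ℝ) ^ 3 := by
      have : (D : ℝ) ^ 3 = (D : ℝ) * D * D := by ring
      rw [this]; linarith only [h9D, hD3r]
    have h2 : Real.log ((D : ℝ) + 4) < Real.log ((D : ℝ) ^ 3) :=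
      Real.log_lt_log (by positivity) h1
    have h3 : Real.log ((D : ℝ) ^ 3) = 3 * ell D := by
      rw [Real.log_pow, ell]; norm_num
    linarith
  have hlogpos : ∀ t : ℝ, 0 < ell D + Real.log (|t| + 4) := fun t => by
    have h1 := Real.log_pos (by linarith only [abs_nonneg t] : (1 : ℝ) < |t| + 4)
    linarith only [h1, hℓ0]
  have haT : 1 - c / (Real.log D + Real.log ((D : ℝ) + 4)) < a := by
    rw [ha]
    have hpos : 0 < ell D + Real.log ((D : ℝ) + 4) := by
      have := hlogpos D; rwa [abs_of_nonneg (by linarith only [hD3r] : (0 : ℝ) ≤ D)] at this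
    have : c / (4 * ell D) < c / (ell D + Real.log ((D : ℝ) + 4)) := by
      apply div_lt_div_of_pos_left hc hpos; linarith only [hlogD4]
    show 1 - c / (ell D + Real.log ((D : ℝ) + 4)) < 1 - c / (4 * ell D)
    linarith only [this]
  have hregion : ∀ t : ℝ, |t| ≤ D → 1 - c / (Real.log D + Real.log (|t| + 4)) ≤ a := fun t ht =>
    (region_mono' hc.le D ht).trans haT.le
  /- the hypotheses of Part 1 -/
  have hzf : ∀ s : ℂ, 1 - c / (Real.log D + Real.log (|s.im| + 4)) ≤ s.re → s ≠ ρ →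
      χ.LFunction s ≠ 0 := fun s h1 h2 => (hfl s h1 h2).1
  have hGM' : ∀ s : ℂ, a ≤ s.re → s.re ≤ 2 → (|s.im| ≤ (D : ℝ) ∨ b ≤ s.re) → ‖G s‖ ≤ M := by
    intro s h1 h2 h3
    refine hGM s ?_ h2 ?_
    · rw [ha] at h1; linarith only [h1, hc4ℓ']
    · rcases h3 with h3 | h3
      · exact Or.inl (by linarith only [h3])
      · exact Or.inr (by rw [hb] at h3; exact h3)
  obtain ⟨Λl, hΛl⟩ : ∃ Λl : ℝ, Λl = CL * (4 * ell D) * (1 + 8 * ell D / c) := ⟨_, rfl⟩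
  obtain ⟨Λh, hΛh⟩ : ∃ Λh : ℝ, Λh = CL * (4 * ell D) * 2 := ⟨_, rfl⟩
  have hΛl0 : 0 ≤ Λl := by rw [hΛl]; positivity
  have hΛh0 : 0 ≤ Λh := by rw [hΛh]; positivity
  -- the `1/L` bound on the left side
  have hLl : ∀ t : ℝ, |t| ≤ D → ‖(χ.LFunction ((a : ℂ) + t * I))⁻¹‖ ≤ Λl := by
    intro t ht
    have hsre : ((a : ℂ) + t * I).re = a := by simp
    have hsim : ((a : ℂ) + t * I).im = t := by simp
    have hsρ : ((a : ℂ) + t * I) ≠ ρ := by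
      intro h; have := congrArg Complex.re h; rw [hsre, Complex.ofReal_re] at this
      linarith only [this, haρ]
    have hreg : 1 - c / (ell D + Real.log (|((a : ℂ) + t * I).im| + 4)) ≤ ((a : ℂ) + t * I).re := by
      rw [hsre, hsim]; exact hregion t ht
    have h := (hfl _ hreg hsρ).2
    rw [hsim] at h
    have hlog : ell D + Real.log (|t| + 4) ≤ 4 * ell D := by
      have : Real.log (|t| + 4) ≤ Real.log ((D : ℝ) + 4) :=
        Real.log_le_log (by positivity) (by linarith only [ht])
      linarith only [this, hlogD4]
    have hdist : c / (8 * ell D) ≤ ‖(a : ℂ) + t * I - ρ‖ := by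
      have h1 := Complex.abs_re_le_norm ((a : ℂ) + t * I - ρ)
      rw [Complex.sub_re, hsre, Complex.ofReal_re] at h1
      have h2 : ρ - a ≤ |a - ρ| := by rw [abs_sub_comm]; exact le_abs_self _
      linarith only [h1, h2, hρa]
    have hinv : ‖(a : ℂ) + t * I - ρ‖⁻¹ ≤ 8 * ell D / c := by
      rw [show 8 * ell D / c = (c / (8 * ell D))⁻¹ by rw [inv_div]]
      exact inv_anti₀ (by positivity) hdist
    calc ‖(χ.LFunction ((a : ℂ) + t * I))⁻¹‖
        ≤ CL * (ell D + Real.log (|t| + 4)) * (1 + ‖(a : ℂ) + t * I - ρ‖⁻¹) := h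
      _ ≤ CL * (4 * ell D) * (1 + 8 * ell D / c) := by gcongr
      _ = Λl := hΛl.symm
  -- the `1/L` bound on the horizontal sides
  have hkey : ∀ σ : ℝ, σ ∈ Icc a b → ∀ τ : ℝ, |τ| = D →
      ‖(χ.LFunction ((σ : ℂ) + τ * I))⁻¹‖ ≤ Λh := by
    intro σ hσ τ hτ
    have hsre : ((σ : ℂ) + τ * I).re = σ := by simp
    have hsim : ((σ : ℂ) + τ * I).im = τ := by simp
    have hsρ : ((σ : ℂ) + τ * I) ≠ ρ := by
      intro h; have := congrArg Complex.im h
      rw [hsim, Complex.ofReal_im] at this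
      rw [this, abs_zero] at hτ; linarith only [hτ, hD3r]
    have hreg : 1 - c / (ell D + Real.log (|((σ : ℂ) + τ * I).im| + 4)) ≤ ((σ : ℂ) + τ * I).re := by
      rw [hsre, hsim]; exact (hregion τ hτ.le).trans hσ.1
    have h := (hfl _ hreg hsρ).2
    rw [hsim, hτ] at h
    have hlog : ell D + Real.log ((D : ℝ) + 4) ≤ 4 * ell D := by linarith only [hlogD4]
    have hdist : (1 : ℝ) ≤ ‖(σ : ℂ) + τ * I - ρ‖ := by
      have h1 := Complex.abs_im_le_norm ((σ : ℂ) + τ * I - ρ)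
      rw [Complex.sub_im, hsim, Complex.ofReal_im, sub_zero, hτ] at h1
      have hDabs : (D : ℝ) ≤ |(D : ℝ)| := le_abs_self _
      linarith only [h1, hDabs, hD1r]
    have hinv : ‖(σ : ℂ) + τ * I - ρ‖⁻¹ ≤ 1 := inv_le_one_of_one_le₀ hdist
    calc ‖(χ.LFunction ((σ : ℂ) + τ * I))⁻¹‖
        ≤ CL * (ell D + Real.log ((D : ℝ) + 4)) * (1 + ‖(σ : ℂ) + τ * I - ρ‖⁻¹) := h
      _ ≤ CL * (4 * ell D) * (1 + 1) := by gcongr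
      _ = Λh := by rw [hΛh]; ring
  have hLh : ∀ σ : ℝ, σ ∈ Icc a b → ‖(χ.LFunction ((σ : ℂ) + (D : ℝ) * I))⁻¹‖ ≤ Λh ∧
      ‖(χ.LFunction ((σ : ℂ) + ((-(D : ℝ) : ℝ) : ℂ) * I))⁻¹‖ ≤ Λh := fun σ hσ =>
    ⟨hkey σ hσ D (abs_of_nonneg (by linarith only [hD3r])),
      hkey σ hσ (-(D : ℝ)) (by rw [abs_neg, abs_of_nonneg (by linarith only [hD3r])])⟩
  /- Part 1 -/
  have hP1 := norm_lineInt_sub_residue_le hχ hG hy1 hF hℓ1 hCδ0 hCδ hc hρ9 hLρ hL'ρ hzf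
    ha12 ha9 haρ hρb hb1 hb2 hD1r haT hM hΛl0 hΛh0 hGM' hLl (by
      intro σ hσ
      have := hLh σ hσ
      simpa using this)
  /- bookkeeping -/
  have hB1 : b / (b - 1) ≤ ell D ^ 9 := by
    rw [hb, add_sub_cancel_left, hαval]
    have hπ3 := Real.pi_gt_three
    have hℓ9 : (2 : ℝ) ^ 9 ≤ ell D ^ 9 := by gcongr
    have h9pos : 0 < ell D ^ 9 := by positivity
    have : (1 + π / ell D ^ 9) / (π / ell D ^ 9) = (ell D ^ 9 + π) / π := by
      field_simp
    rw [this, div_le_iff₀ (by positivity)]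
    nlinarith only [hπ3, hℓ9, Real.pi_lt_four]
  have hyb : y ^ b ≤ y * Real.exp (3 * π) := by
    rw [hb, Real.rpow_add hy0, Real.rpow_one]
    exact mul_le_mul_of_nonneg_left hyα hy0.le
  have hya : y ^ a ≤ y * Section7dStatements.eps1 (c / 4) D := by
    rw [ha, sub_eq_add_neg, Real.rpow_add hy0, Real.rpow_one]
    exact mul_le_mul_of_nonneg_left hyc hy0.le
  have hE0 : 0 ≤ Section7dStatements.eps1 (c / 4) D := (Real.exp_pos _).le
  refine hP1.trans ?_
  rw [hDexp, hΛl, hΛh]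
  have h := partOne_arith (ℓ := ell D) (c := c) (CL := CL) (Q := Cδ * ell D ^ 5190) (M := M)
    (y := y) (yb := y ^ b) (ya := y ^ a) (E := Section7dStatements.eps1 (c / 4) D)
    (B1 := b / (b - 1)) (ba := b - a) hℓ2 hc hCL (by positivity) hM hy0.le hE0
    (Real.rpow_nonneg hy0.le _) (Real.rpow_nonneg hy0.le _) hyb hya
    (div_nonneg (by linarith only [hb1]) (by linarith only [hb1])) hB1 hba0 hba1
  refine h.trans ?_
  have hQ : (2 * Real.exp (3 * π) + 16 * Real.exp (3 * π) * CL + 16 * π * CL * (1 + 8 / c)) *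
      (Cδ * ell D ^ 5190 * ell D ^ 10) =
      (2 * Real.exp (3 * π) + 16 * Real.exp (3 * π) * CL + 16 * π * CL * (1 + 8 / c)) * Cδ *
        ell D ^ 5200 := by
    rw [mul_assoc (Cδ), ← pow_add]; ring
  rw [hQ]
  exact mul_le_mul_of_nonneg_left habs (by positivity)

set_option maxHeartbeats 800000 in -- one long parameter bookkeeping (two discs, the `L′` floor, δ near 1)
/-- **Part 2 at Zhang's parameters.** Discs `ball 1 α` and `ball 1 (1/(2𝓛))`, `T ≤ y`,
`log y ≤ 3𝓛⁹`, Lemma 5.4 (ii) for `δ` near `1`, the data of `Lemma84.exceptional_package`, and the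
largeness conditions `2K, 8K/c, 384e⁴C_LK, A₂ ≤ 𝓛`: then
`‖G(ρ)y^ρδ(ρ)/L′(ρ,χ) − G(1)yδ(1)/L′(1,χ)‖ ≤ M·y·𝓛⁻²⁰⁰⁰`.
[cite: Zhang2022LandauSiegel, §15 p.82 ("by (5.15) we can replace ρ̃ by 1"); §16 p.90] -/
theorem partTwo_final (hχ : χ ≠ 1) (hG : DifferentiableOn ℂ G {s : ℂ | 9 / 10 < s.re})
    (hℓ8 : 8 ≤ ell D) {c CL K : ℝ} (hc : 0 < c) (hCL : 0 ≤ CL) (hK : 0 < K)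
    {ρ : ℝ} (hρ1 : ρ < 1) (hρK : 1 - ρ ≤ K * (ell D ^ 2022)⁻¹) (hLρ : χ.LFunction ρ = 0)
    (hL'ρ : deriv χ.LFunction ρ ≠ 0)
    (hfl : ∀ s : ℂ, 1 - c / (ell D + Real.log (|s.im| + 4)) ≤ s.re → s ≠ ρ →
      χ.LFunction s ≠ 0 ∧
        ‖(χ.LFunction s)⁻¹‖ ≤ CL * (ell D + Real.log (|s.im| + 4)) * (1 + ‖s - ρ‖⁻¹))
    (hKℓ : 8 * K / c ≤ ell D) (hK2 : 2 * K ≤ ell D) (hK3 : 384 * Real.exp 4 * CL * K ≤ ell D)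
    {C54 : ℝ}
    (h54ii : ∀ s : ℂ, ‖s - 1‖ < 10 * alpha D → ‖deltaW D s - 1‖ ≤ C54 * alpha D * Real.log (ell D))
    {M : ℝ} (hM : 0 ≤ M)
    (hGM : ∀ s : ℂ, 1 - 1 / (16 * ell D) ≤ s.re → s.re ≤ 2 →
      (|s.im| ≤ (D : ℝ) + 1 ∨ 1 + alpha D ≤ s.re) → ‖G s‖ ≤ M)
    (hTy : bigT D ≤ y) (hlogy : Real.log y ≤ 3 * ell D ^ 9)
    (hA₂ℓ : K * (Real.exp (3 * π) * (1 + |C54|) * (12 * CL + 2304 * Real.exp 4 * CL ^ 2)) ≤ ell D) :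
    ‖G ρ * (y : ℂ) ^ (ρ : ℂ) * deltaW D ρ / deriv χ.LFunction ρ -
        G 1 * (y : ℂ) * deltaW D 1 / deriv χ.LFunction 1‖ ≤ M * y * (ell D ^ 2000)⁻¹ := by
  /- parameters -/
  have hℓ4 : 4 ≤ ell D := by linarith only [hℓ8]
  have hℓ2 : 2 ≤ ell D := by linarith only [hℓ8]
  have hℓ1 : 1 ≤ ell D := by linarith only [hℓ8]
  have hℓ0 : 0 < ell D := by linarith only [hℓ8]
  obtain ⟨hD3r, hD3, hDexp, hα0, hαℓ, hℓinv, hαlogP, hlogP, hαval⟩ := param_facts hℓ4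
  have hℓpow : ∀ n : ℕ, n ≠ 0 → ell D ≤ ell D ^ n := fun n hn => le_self_pow₀ hℓ1 hn
  have hℓ2022 : 0 < ell D ^ 2022 := by positivity
  obtain ⟨hlog3, hlog4⟩ := log_three_four
  have hα4 : alpha D ≤ 1 / 4 := hαℓ.trans hℓinv
  have hα16 : alpha D ≤ 1 / (16 * ell D) := by
    rw [hαval, div_le_div_iff₀ (by positivity) (by positivity)]
    have h8 : (2 : ℝ) ^ 8 ≤ ell D ^ 8 := by gcongr
    have hπ4 := Real.pi_lt_four
    have : π * (16 * ell D) ≤ 64 * ell D := by nlinarith only [hπ4, hℓ0]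
    calc π * (16 * ell D) ≤ 64 * ell D := this
      _ ≤ ell D ^ 8 * ell D := by
          have : (64 : ℝ) ≤ ell D ^ 8 := by linarith only [h8]
          exact mul_le_mul_of_nonneg_right this hℓ0.le
      _ = 1 * ell D ^ 9 := by ring
  have hα20 : alpha D ≤ 1 / 20 := by
    have : 1 / (16 * ell D) ≤ 1 / 20 := one_div_le_one_div_of_le (by norm_num) (by linarith only [hℓ8])
    exact hα16.trans this
  -- `K/ℓ²⁰²² ≤ c/(8ℓ)`
  have hs1 : K * (ell D ^ 2022)⁻¹ ≤ c / (8 * ell D) := by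
    have h1 : 8 * K / c ≤ ell D ^ 2021 := hKℓ.trans (hℓpow 2021 (by norm_num))
    rw [div_le_iff₀ hc] at h1
    rw [← div_eq_mul_inv, div_le_div_iff₀ hℓ2022 (by positivity)]
    calc K * (8 * ell D) = 8 * K * ell D := by ring
      _ ≤ ell D ^ 2021 * c * ell D := by gcongr
      _ = c * ell D ^ 2022 := by ring
  have hρc8 : 1 - ρ ≤ c / (8 * ell D) := hρK.trans hs1
  -- `1 − ρ < α`
  have hs2 : 1 - ρ < alpha D := by
    rw [hαval]
    refine lt_of_le_of_lt hρK ?_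
    rw [← div_eq_mul_inv, div_lt_div_iff₀ hℓ2022 (by positivity)]
    have h1 : K < ell D ^ 2013 := by
      have := hℓpow 2013 (by norm_num); linarith only [this, hK2, hK]
    have h2 : (1 : ℝ) ≤ π := by linarith only [Real.pi_gt_three]
    calc K * ell D ^ 9 < ell D ^ 2013 * ell D ^ 9 := by gcongr
      _ = 1 * ell D ^ 2022 := by ring
      _ ≤ π * ell D ^ 2022 := by gcongr
  -- `1 − ρ < 1/(2ℓ)`
  have hs3 : 1 - ρ < 1 / (2 * ell D) := by
    refine lt_of_le_of_lt hρK ?_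
    rw [← div_eq_mul_inv, div_lt_div_iff₀ hℓ2022 (by positivity)]
    have h1 : 2 * K < ell D ^ 2021 := by
      have := hℓpow 2021 (by norm_num)
      have h2022 : ell D < ell D ^ 2021 := by
        calc ell D = ell D ^ 1 := (pow_one _).symm
          _ < ell D ^ 2021 := pow_lt_pow_right₀ (by linarith only [hℓ8]) (by norm_num)
      linarith only [h2022, hK2]
    calc K * (2 * ell D) = 2 * K * ell D := by ring
      _ < ell D ^ 2021 * ell D := by gcongr
      _ = 1 * ell D ^ 2022 := by ring
  -- `ρ` lies in the region for real arguments
  have hρreg : 1 - c / (ell D + Real.log 4) ≤ ρ := by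
    have hpos : 0 < ell D + Real.log 4 := by
      have := Real.log_pos (by norm_num : (1 : ℝ) < 4); linarith only [this, hℓ0]
    have h1 : c / (8 * ell D) ≤ c / (ell D + Real.log 4) := by
      apply div_le_div_of_nonneg_left hc.le hpos
      linarith only [hlog4, hℓ1]
    linarith only [h1, hρc8]
  /- `y` -/
  have hT1 : 1 ≤ bigT D := by rw [bigT]; exact Real.one_le_exp (by positivity)
  have hy1 : 1 ≤ y := hT1.trans hTy
  have hy0 : 0 < y := by linarith only [hy1]
  have hyα : y ^ alpha D ≤ Real.exp (3 * π) := by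
    rw [Real.rpow_def_of_pos hy0, Real.exp_le_exp]
    calc Real.log y * alpha D ≤ 3 * ell D ^ 9 * alpha D :=
          mul_le_mul_of_nonneg_right hlogy hα0.le
      _ = 3 * π := by rw [hαval]; field_simp
  have hYb : y ^ (1 + alpha D) ≤ y * Real.exp (3 * π) := by
    rw [Real.rpow_add hy0, Real.rpow_one]
    exact mul_le_mul_of_nonneg_left hyα hy0.le
  /- the disc `ball 1 α`: `G` and `δ` -/
  have hGB : ∀ z ∈ ball (1 : ℂ) (alpha D), ‖G z‖ ≤ M := by
    intro z hz
    obtain ⟨h1, h2, h3⟩ := re_im_of_mem_ball hz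
    refine hGM z (by linarith only [h1, hα16]) (by linarith only [h2, hα4]) (Or.inl ?_)
    have : (0 : ℝ) ≤ D := Nat.cast_nonneg D
    linarith only [h3, hα4, this]
  obtain ⟨Bδ, hBδ⟩ : ∃ Bδ : ℝ, Bδ = 1 + C54 * alpha D * Real.log (ell D) := ⟨_, rfl⟩
  have hδB : ∀ z ∈ ball (1 : ℂ) (alpha D), ‖deltaW D z‖ ≤ Bδ := by
    intro z hz
    rw [mem_ball, dist_eq_norm] at hz
    have h := h54ii z (by linarith only [hz, hα0])
    calc ‖deltaW D z‖ = ‖(deltaW D z - 1) + 1‖ := by rw [sub_add_cancel]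
      _ ≤ ‖deltaW D z - 1‖ + ‖(1 : ℂ)‖ := norm_add_le _ _
      _ ≤ C54 * alpha D * Real.log (ell D) + 1 := by rw [norm_one]; gcongr
      _ = Bδ := by rw [hBδ]; ring
  have hαlog : alpha D * Real.log (ell D) ≤ 1 := by
    have h1 : Real.log (ell D) ≤ ell D := by
      have := Real.log_le_sub_one_of_pos hℓ0; linarith only [this]
    have h2 : alpha D * Real.log (ell D) ≤ (ell D)⁻¹ * ell D :=
      mul_le_mul hαℓ h1 (Real.log_nonneg hℓ1) (by positivity)
    rw [inv_mul_cancel₀ hℓ0.ne'] at h2; exact h2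
  have hαlog0 : 0 ≤ alpha D * Real.log (ell D) := mul_nonneg hα0.le (Real.log_nonneg hℓ1)
  have hBδB₀ : Bδ ≤ 1 + |C54| := by
    rw [hBδ]
    have : C54 * alpha D * Real.log (ell D) ≤ |C54| := by
      calc C54 * alpha D * Real.log (ell D) = C54 * (alpha D * Real.log (ell D)) := by ring
        _ ≤ |C54| * (alpha D * Real.log (ell D)) := by gcongr; exact le_abs_self _
        _ ≤ |C54| * 1 := by gcongr
        _ = |C54| := mul_one _
    linarith only [this]
  /- the floor for real arguments right of `ρ` -/
  obtain ⟨Λ, hΛ⟩ : ∃ Λ : ℝ, Λ = CL * (ell D + Real.log 4) := ⟨_, rfl⟩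
  have hfloor : ∀ x : ℝ, ρ < x → x < ρ + 1 → χ.LFunction x ≠ 0 ∧
      ‖(χ.LFunction x)⁻¹‖ ≤ Λ * (1 + |x - ρ|⁻¹) := by
    intro x hx1 hx2
    have hxρ : (x : ℂ) ≠ ρ := by
      intro h; have := Complex.ofReal_inj.mp h; linarith only [this, hx1]
    have hreg : 1 - c / (ell D + Real.log (|(x : ℂ).im| + 4)) ≤ (x : ℂ).re := by
      simp only [Complex.ofReal_im, abs_zero, zero_add, Complex.ofReal_re]
      linarith only [hρreg, hx1]
    obtain ⟨hne, hbd⟩ := hfl (x : ℂ) hreg hxρ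
    refine ⟨hne, ?_⟩
    simp only [Complex.ofReal_im, abs_zero, zero_add] at hbd
    have hn : ‖(x : ℂ) - ρ‖ = |x - ρ| := by
      rw [← Complex.ofReal_sub, Complex.norm_real, Real.norm_eq_abs]
    rw [hn] at hbd
    rw [hΛ]; exact hbd
  /- the disc `ball 1 (1/(2ℓ))`: `L ≪ ℓ` on `ball 1 (1/ℓ)` -/
  have hr' : (0 : ℝ) < 1 / (2 * ell D) := by positivity
  obtain ⟨BL, hBL⟩ : ∃ BL : ℝ, BL = ((D : ℝ) * (|(0 : ℝ)| + 3)) ^ (2 * (1 / ell D)) *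
      (4 + Real.log D + Real.log (|(0 : ℝ)| + 3)) := ⟨_, rfl⟩
  have hBL' : ∀ w ∈ ball (1 : ℂ) (2 * (1 / (2 * ell D))), ‖χ.LFunction w‖ ≤ BL := by
    intro w hw
    have hε8 : 1 / ell D ≤ 1 / 8 := one_div_le_one_div_of_le (by norm_num) hℓ8
    have hmem : w ∈ ball (1 + ((1 / ell D : ℝ) : ℂ) + (0 : ℝ) * I) (3 * (1 / ell D)) := by
      rw [mem_ball] at hw ⊢
      have h1 : dist w (1 + ((1 / ell D : ℝ) : ℂ) + (0 : ℝ) * I) ≤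
          dist w 1 + dist (1 : ℂ) (1 + ((1 / ell D : ℝ) : ℂ) + (0 : ℝ) * I) := dist_triangle _ _ _
      have h2 : dist (1 : ℂ) (1 + ((1 / ell D : ℝ) : ℂ) + (0 : ℝ) * I) = 1 / ell D := by
        rw [dist_eq_norm]
        have : (1 : ℂ) - (1 + ((1 / ell D : ℝ) : ℂ) + (0 : ℝ) * I) = -(((1 / ell D : ℝ) : ℂ)) := by
          push_cast; ring
        rw [this, norm_neg, Complex.norm_real, Real.norm_of_nonneg (by positivity)]
      have h3 : 2 * (1 / (2 * ell D)) = 1 / ell D := by field_simp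
      rw [h3] at hw
      have h4 : 0 < 1 / ell D := by positivity
      linarith only [hw, h1, h2, h4]
    have h := Section8Floor.norm_LFunction_le_on_ball χ hχ (ε := 1 / ell D) (t := 0)
      (by positivity) hε8 hmem
    rw [hBL]; exact h
  have hBLle : BL ≤ 4 * Real.exp 4 * ell D := by
    rw [hBL]
    simp only [abs_zero, zero_add]
    have h1 : ((D : ℝ) * 3) ^ (2 * (1 / ell D)) ≤ Real.exp 4 := by
      have hpos : (0 : ℝ) < (D : ℝ) * 3 := by positivity
      rw [Real.rpow_def_of_pos hpos, Real.exp_le_exp,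
        Real.log_mul (by positivity) (by norm_num)]
      have hlD : Real.log (D : ℝ) = ell D := rfl
      rw [hlD]
      have : (ell D + Real.log 3) * (2 * (1 / ell D)) = 2 + 2 * Real.log 3 / ell D := by
        field_simp
      rw [this]
      have h2 : 2 * Real.log 3 / ell D ≤ 2 := by
        rw [div_le_iff₀ hℓ0]; nlinarith only [hlog3, hℓ2]
      linarith only [h2]
    have hlD : Real.log (D : ℝ) = ell D := rfl
    have h2 : 4 + Real.log (D : ℝ) + Real.log 3 ≤ 4 * ell D := by
      rw [hlD]; linarith only [hlog3, hℓ2]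
    have h3 : 0 ≤ 4 + Real.log (D : ℝ) + Real.log 3 := by
      rw [hlD]; have := Real.log_nonneg (by norm_num : (1:ℝ) ≤ 3); linarith only [this, hℓ0]
    calc ((D : ℝ) * 3) ^ (2 * (1 / ell D)) * (4 + Real.log (D : ℝ) + Real.log 3)
        ≤ Real.exp 4 * (4 * ell D) := mul_le_mul h1 h2 h3 (Real.exp_pos _).le
      _ = 4 * Real.exp 4 * ell D := by ring
  have hBL0 : 0 ≤ BL := le_trans (norm_nonneg _) (hBL' 1 (mem_ball_self (by positivity)))
  have hWeq : 2 * (BL / (1 / (2 * ell D))) / (1 / (2 * ell D)) = 8 * ell D ^ 2 * BL := by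
    field_simp; ring
  have hW : 2 * (BL / (1 / (2 * ell D))) / (1 / (2 * ell D)) ≤ 32 * Real.exp 4 * ell D ^ 3 := by
    rw [hWeq]
    calc 8 * ell D ^ 2 * BL ≤ 8 * ell D ^ 2 * (4 * Real.exp 4 * ell D) := by gcongr
      _ = 32 * Real.exp 4 * ell D ^ 3 := by ring
  have hW0 : 0 ≤ 2 * (BL / (1 / (2 * ell D))) / (1 / (2 * ell D)) := by rw [hWeq]; positivity
  have hΛ3 : Λ ≤ 3 * CL * ell D := by
    rw [hΛ]
    calc CL * (ell D + Real.log 4) ≤ CL * (3 * ell D) := by gcongr; linarith only [hlog4, hℓ2]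
      _ = 3 * CL * ell D := by ring
  have hΛ0 : 0 ≤ Λ := by
    rw [hΛ]; have := Real.log_nonneg (by norm_num : (1:ℝ) ≤ 4); positivity
  have hsmall : 4 * Λ * (2 * (BL / (1 / (2 * ell D))) / (1 / (2 * ell D)) * (1 - ρ)) ≤ 1 := by
    have h1 : 384 * Real.exp 4 * CL * K ≤ ell D ^ 2018 := hK3.trans (hℓpow 2018 (by norm_num))
    have hρ0 : 0 ≤ 1 - ρ := by linarith only [hρ1]
    calc 4 * Λ * (2 * (BL / (1 / (2 * ell D))) / (1 / (2 * ell D)) * (1 - ρ))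
        ≤ 4 * (3 * CL * ell D) * ((32 * Real.exp 4 * ell D ^ 3) * (K * (ell D ^ 2022)⁻¹)) := by
          gcongr
      _ = (384 * Real.exp 4 * CL * K) * ell D ^ 4 * (ell D ^ 2022)⁻¹ := by ring
      _ ≤ ell D ^ 2018 * ell D ^ 4 * (ell D ^ 2022)⁻¹ := by gcongr
      _ = 1 := by rw [← pow_add]; field_simp
  /- Part 2 -/
  have hP2 := norm_residue_sub_main_le hχ hG hy1 hℓ1 hρ1 hLρ hL'ρ hα0 hα20 hs2 hM hGB hδB
    hfloor hr' hs3 hBL' hsmall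
  refine hP2.trans ?_
  have hBδ0 : 0 ≤ Bδ := le_trans (norm_nonneg _) (hδB 1 (mem_ball_self hα0))
  have hαinv : (alpha D)⁻¹ ≤ ell D ^ 9 := by
    rw [hαval, inv_div]
    exact div_le_self (by positivity) (by linarith only [Real.pi_gt_three])
  have h := partTwo_arith (ℓ := ell D) (CL := CL) (M := M) (y := y) (Y := y ^ (1 + alpha D))
    (Bδ := Bδ) (B₀ := 1 + |C54|) (α := alpha D) (Λ := Λ)
    (W := 2 * (BL / (1 / (2 * ell D))) / (1 / (2 * ell D))) (ε := K * (ell D ^ 2022)⁻¹)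
    (δ := 1 - ρ) hℓ1 hCL hM hy0.le hYb hBδ0 hBδB₀ hα0 hαinv hΛ0 hΛ3 hW0 hW
    (by linarith only [hρ1]) hρK
  refine h.trans ?_
  apply mul_le_mul_of_nonneg_left _ (by positivity)
  -- `A₂ ℓ¹⁰/ℓ²⁰²² ≤ 1/ℓ²⁰⁰⁰`
  have hA₂12 : K * (Real.exp (3 * π) * (1 + |C54|) * (12 * CL + 2304 * Real.exp 4 * CL ^ 2)) ≤
      ell D ^ 12 := hA₂ℓ.trans (hℓpow 12 (by norm_num))
  have h2000 : 0 < ell D ^ 2000 := by positivity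
  calc Real.exp (3 * π) * (1 + |C54|) * (12 * CL + 2304 * Real.exp 4 * CL ^ 2) * ell D ^ 10 *
        (K * (ell D ^ 2022)⁻¹)
      = K * (Real.exp (3 * π) * (1 + |C54|) * (12 * CL + 2304 * Real.exp 4 * CL ^ 2)) *
          ell D ^ 10 * (ell D ^ 2022)⁻¹ := by ring
    _ ≤ ell D ^ 12 * ell D ^ 10 * (ell D ^ 2022)⁻¹ := by gcongr
    _ = (ell D ^ 2000)⁻¹ := by field_simp

end Final

/-! ## §10. The engine -/

section Main

/-- **THE ENGINE (Zhang's "treatment of (7.19)" for the integrands of (15.8)/(16.4), with the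
replacement `ρ̃ ↦ 1` of (5.15)).** There is an absolute `C ≥ 0` such that for all large `D`, every
real primitive `χ (mod D)` satisfying (A), every `G` holomorphic on `σ > 9/10` with `‖G‖ ≤ M` on
`{1 − 1/(16𝓛) ≤ σ ≤ 2} ∩ ({|t| ≤ D + 1} ∪ {σ ≥ 1 + α})`, and every `y` with `T ≤ y` and
`log y ≤ 3𝓛⁹`:
`‖(1/2πi)∫_{(2)} G(s)L(s,χ)⁻¹yˢδ(s)ds − G(1)·y·δ(1)/L′(1,χ)‖ ≤ C·M·y·𝓛⁻²⁰⁰⁰`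
(the line integral in the house style `(1/(2π))∫_ℝ …(2+it)dt`; `δ` = `Skeleton.deltaW`,
`α` = `Skeleton.alpha`, `T` = `Skeleton.bigT`, `𝓛` = `Skeleton.ell`). All analytic inputs are tree
theorems (`Lemma84.exceptional_package`, `Skeleton.norm_deltaW_le`, `Skeleton.lemma54_holds`,
`Section8Floor.norm_LFunction_le_on_ball`, `Section7dStatements.absorb_pow_log_eps1`). CONDITIONAL on
(A), as the manuscript. [cite: Zhang2022LandauSiegel, §15 p.82; §16 p.90; §7 p.40; §5 (5.15)] -/
theorem deltaContourShift :
    ∃ C : ℝ, 0 ≤ C ∧ ForAllLarge fun D _ χ => AssumptionA D χ →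
      ∀ (G : ℂ → ℂ) (M : ℝ), 0 ≤ M →
        DifferentiableOn ℂ G {s : ℂ | 9 / 10 < s.re} →
        (∀ s : ℂ, 1 - 1 / (16 * ell D) ≤ s.re → s.re ≤ 2 →
            (|s.im| ≤ (D : ℝ) + 1 ∨ 1 + alpha D ≤ s.re) → ‖G s‖ ≤ M) →
        ∀ y : ℝ, bigT D ≤ y → Real.log y ≤ 3 * ell D ^ 9 →
          ‖(1 / (2 * π) : ℂ) * (∫ t : ℝ, G (2 + t * I) * (χ.LFunction (2 + t * I))⁻¹ *
                (y : ℂ) ^ (2 + t * I : ℂ) * deltaW D (2 + t * I)) -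
              G 1 * (y : ℂ) * deltaW D 1 / deriv χ.LFunction 1‖ ≤
            C * M * y * (ell D ^ 2000)⁻¹ := by
  obtain ⟨c, hc, hc4, CL, hCL0, K, hK, D₁, hpack⟩ := Lemma84.exceptional_package
  obtain ⟨Cδ, hCδ0, hCδ⟩ := exists_deltaW_bound
  obtain ⟨k54, C54, D₂, h54⟩ := lemma54_holds
  -- the constants of the two halves and the largeness threshold
  have hA₁0 : 0 ≤ (2 * Real.exp (3 * π) + 16 * Real.exp (3 * π) * CL + 16 * π * CL * (1 + 8 / c)) *
      Cδ := by positivity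
  have hc41 : c / 4 ≤ 1 := by linarith
  obtain ⟨D₃, hD₃⟩ := exists_absorb_contour _ (c / 4) hA₁0 (by positivity) hc41
  obtain ⟨D₄, hD₄⟩ := exists_forall_le_ell (8 + 8 * K / c + 2 * K + 384 * Real.exp 4 * CL * K +
    K * (Real.exp (3 * π) * (1 + |C54|) * (12 * CL + 2304 * Real.exp 4 * CL ^ 2)))
  refine ⟨2, by norm_num, max (max D₁ D₂) (max D₃ D₄),
    fun D _ χ hD hq hprim hA G M hM hG hGM y hTy hlogy => ?_⟩
  have hD₁ : D₁ ≤ D := le_trans (le_trans (le_max_left _ _) (le_max_left _ _)) hD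
  have hD₂ : D₂ ≤ D := le_trans (le_trans (le_max_right _ _) (le_max_left _ _)) hD
  have hD₃' : D₃ ≤ D := le_trans (le_trans (le_max_left _ _) (le_max_right _ _)) hD
  have hD₄' : D₄ ≤ D := le_trans (le_trans (le_max_right _ _) (le_max_right _ _)) hD
  have hL := hD₄ D hD₄'
  have hKc : 0 ≤ 8 * K / c := by positivity
  have hK2' : 0 ≤ 2 * K := by positivity
  have hK3' : 0 ≤ 384 * Real.exp 4 * CL * K := by positivity
  have hA₂' : 0 ≤ K * (Real.exp (3 * π) * (1 + |C54|) * (12 * CL + 2304 * Real.exp 4 * CL ^ 2)) := by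
    positivity
  have hℓ8 : 8 ≤ ell D := by linarith only [hL, hKc, hK2', hK3', hA₂']
  have hKℓ : 8 * K / c ≤ ell D := by linarith only [hL, hKc, hK2', hK3', hA₂']
  have hK2 : 2 * K ≤ ell D := by linarith only [hL, hKc, hK2', hK3', hA₂']
  have hK3 : 384 * Real.exp 4 * CL * K ≤ ell D := by linarith only [hL, hKc, hK2', hK3', hA₂']
  have hA₂ℓ : K * (Real.exp (3 * π) * (1 + |C54|) * (12 * CL + 2304 * Real.exp 4 * CL ^ 2)) ≤
      ell D := by linarith only [hL, hKc, hK2', hK3', hA₂']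
  have hℓ4 : 4 ≤ ell D := by linarith only [hℓ8]
  have hℓ1 : 1 ≤ ell D := by linarith only [hℓ8]
  obtain ⟨-, hD3, -⟩ := param_facts hℓ4
  have hχ1 : χ ≠ 1 := ne_one_of_isPrimitive_of_three_le hprim hD3
  have hA' : ‖χ.LFunction 1‖ < (Real.log D ^ 2022)⁻¹ := by rw [← one_div]; exact hA
  obtain ⟨ρ, hρ1, hρK, hLρ, hL'ρ, hfl⟩ := hpack D χ hD₁ hχ1 hA'
  have h54ii : ∀ s : ℂ, ‖s - 1‖ < 10 * alpha D →
      ‖deltaW D s - 1‖ ≤ C54 * alpha D * Real.log (ell D) := fun s hs => ((h54 D χ hD₂ hq hprim) s).2 hs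
  -- the integrand
  set F : ℂ → ℂ := fun s => G s * (χ.LFunction s)⁻¹ * (y : ℂ) ^ s * deltaW D s with hF0
  have hF : ∀ s, F s = G s * (χ.LFunction s)⁻¹ * (y : ℂ) ^ s * deltaW D s := fun s => rfl
  have hP1 := partOne_final hχ1 hG hF hℓ8 hCδ0 (hCδ D hℓ1) hc hc4 hCL0 hρ1 hρK hLρ hL'ρ hfl hKℓ hM
    hGM hTy hlogy (hD₃ D hD₃' hℓ1)
  have hP2 := partTwo_final (G := G) (y := y) hχ1 hG hℓ8 hc hCL0 hK hρ1 hρK hLρ hL'ρ hfl hKℓ hK2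
    hK3 h54ii hM hGM hTy hlogy hA₂ℓ
  have hint : (∫ t : ℝ, G (2 + t * I) * (χ.LFunction (2 + t * I))⁻¹ * (y : ℂ) ^ (2 + t * I : ℂ) *
      deltaW D (2 + t * I)) = ∫ t : ℝ, F ((2 : ℝ) + t * I) := by
    congr 1
  rw [hint]
  calc ‖(1 / (2 * π) : ℂ) * (∫ t : ℝ, F ((2 : ℝ) + t * I)) -
          G 1 * (y : ℂ) * deltaW D 1 / deriv χ.LFunction 1‖
      = ‖((1 / (2 * π) : ℂ) * (∫ t : ℝ, F ((2 : ℝ) + t * I)) -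
            G ρ * (y : ℂ) ^ (ρ : ℂ) * deltaW D ρ / deriv χ.LFunction ρ) +
          (G ρ * (y : ℂ) ^ (ρ : ℂ) * deltaW D ρ / deriv χ.LFunction ρ -
            G 1 * (y : ℂ) * deltaW D 1 / deriv χ.LFunction 1)‖ := by rw [sub_add_sub_cancel]
    _ ≤ _ := norm_add_le _ _
    _ ≤ M * y * (ell D ^ 2000)⁻¹ + M * y * (ell D ^ 2000)⁻¹ := add_le_add hP1 hP2
    _ = 2 * M * y * (ell D ^ 2000)⁻¹ := by ring

end Main

end Literature.NumberTheory.LFunctions.Zhang2022.DeltaContourShift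

end
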